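import Summits.QuantumFields.YangMills.Theorems.UnitScaleTiltProp7SymFrameGaugeResponse
import Literature.MathematicalPhysics.QuantumFieldTheory.Balaban1983to89.BlockAveragingEMLAnalyticMean
import HarnessLib

/-!
# Route `UnitScaleTilt`, crux K1 child «MinimiserStabilityRegPr» (stmt-QuantumFields-19200), skeleton v10, stub `stub_existenceMinimalOrbit` (EX), route (α) — **THE RESPONSE OF THE SYMMETRIC
# FRAME TOWER TO GAUGE DIRECTIONS AT A GENERAL CHART POINT** (FR₁: the background-only response FR₀ = ✓`Prop7SymFrameGaugeResponse` moved to the gauge orbit through an arbitrary field `U′`,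
# frames still against `U₀`) — the letters of the frame-corrected operator `𝓚_{A₁}` whose onto-ness is the located residue (P1) of the `hsplit` row (✓`Prop7TwistedSliceGaugeOnto`).

Cell `ym3-torus`, width seat `ym-ust-20520-w5` (gen 6).  THEOREMS ONLY (0 `def`, 0 `sorry`).  `--supports stmt-QuantumFields-19200 --as helper`, count-neutral.  YM₃ on T³ is a ladder rung (R3), not
the Clay problem; nothing here claims the stub, the crux, d = 4 or the mass gap.

THE POINT.  Along `W_t = U′^{g_t}` (`g_0 = 1`, `ġ = N`) with the frames `v_k(t) = frameAccU k U₀ W_t` taken against a DIFFERENT background `U₀`, nothing is `1` at `t = 0` any more: the level-`k`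
double bar is still EXACTLY `Ē′^{h_t}` (`Ē′ = emlIterU k U′`, `h_t = v_k(t)⁻¹·(g_t∘x̂⁽ᵏ⁾)`, ✓`dbarCovIterU_eq_gaugeActT_frameAccU` + ✓`emlIterU_gaugeActT`), but `h_0 = ν_k⁻¹` (`ν_k = v_k(U₀,U′)`) and the
centre-stair transporters `τ_i(y) = tstairU Ū₀ (Ē′^{h_0}) y i` sit at a general point of the `eml` ball.  With the RIGHT-trivialised velocity `ω = ḣ·h_0⁻¹` the transporters respond by a LEFT
multiplication, **`τ̇_i = (ω(ŷ) − Ad_{P_i} ω(x_i))·τ_i`**, `P_i = (Ē′^{h_0})(Γ_{y,i})` the holonomy of the ACTUAL level-`k` double-bar field (§2); the one-level frame responds through `D eml` at `τ`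
(§3, `‖τ − 1‖ < 1/3`, ✓`isAnalyticMean_eml`); and the accumulated frame obeys the product rule `v̇_{k+1}(y) = v̇_k(ŷ)·w_k(y) + ν_k(ŷ)·ẇ_k(y)` with `ω = Ad_{ν_k⁻¹}(N∘x̂⁽ᵏ⁾ − v̇_k ν_k⁻¹)` (§4).  At the
background (`U′ = U₀`: `ν = 1`, `τ = 1`, `D eml(1) = mean`) this is FR₀ §4 and the Ad-average recursion; away from it, `D eml(τ) = mean + O(‖τ − 1‖)` (✓`norm_fderiv_eml_sub_mean_le`, `C′_M = 144`)
makes each level of `𝓚_{A₁}` a perturbed block Ad-average — the per-level Neumann route to (P1), whose constants ARE in the tree.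

WHAT IS PROVED (sorry-free, no definition, any complete normed `ℂ`-algebra `𝔸`): §1 `hasDerivAt_units_inv` (inverse of a unit-valued curve at a general point); §2 ★★`hasDerivAt_tstairU_gaugeFamily_at`;
§3 ★★`hasDerivAt_vframeCovU_gaugeFamily_at`; §4 ★★★`hasDerivAt_frameAccU_succ_at` (the inductive step of the tower along `U′^{g_t}` with frames against `U₀`); §5 ★★`norm_fderiv_eml_mul_sub_mean_mul_le`
(`‖D eml(τ)(σ·τ) − (mean σ)·eml τ‖ ≤ 163‖σ‖‖τ − 1‖` for `‖τ − 1‖ ≤ 1/24`: the one-level response is the arithmetic mean up to `O(‖τ − 1‖)`); §6 `surjective_of_norm_sub_smul_one_lt` (the per-level Neumann letter).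
HONEST SCOPE: exact first-order calculus (no estimate); the smallness `‖τ − 1‖ < 1/3` is a displayed hypothesis (at printed-regular pairs it is the towers' closeness); nothing of print is asserted.

References: T. Bałaban, CMP 98 (1985) 17–51 [Balaban1985Averaging] ((8)–(9) p.18, (11) p.19, (58) p.27, (82) p.30, (87) p.31, (97) p.32); CMP 99 (1985) 389–434 [Balaban1985BackgroundPropagators]
((3.19) p.393, (3.114)–(3.115) p.418).
-/

set_option autoImplicit false

noncomputable section

open scoped BigOperators Topology
open Filter NormedSpace Metric

namespace Summit.QuantumFields.YangMills.Theorems.Prop7SymFrameGaugeResponseAt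

open Literature.MathematicalPhysics.QuantumFieldTheory.Balaban1983to89
open T4Continuum BlockAveraging ExpMeanLog MatrixLog
open B10Eq27TorusAxialLog (holT holT_nil gaugeActT gaugeActT_apply transl)
open B7Prop1Explicit (expUnit val_expUnit val_inv_expUnit disp)
open Summit.QuantumFields.YangMills.Theorems.Prop7SymAvgTwSym (tstairU tstairU_def vframeCovU coe_vframeCovU)
open Summit.QuantumFields.YangMills.Theorems.Prop7SymFrameGaugeResponse (holT_gaugeActT)
open BlockAveragingEMLAnalyticMean (isAnalyticMean_eml)

variable {P : Params} {𝔸 : Type*} [NormedRing 𝔸] [NormedAlgebra ℂ 𝔸] [CompleteSpace 𝔸] {j : ℕ}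

/-! ## §1 The inverse of a unit-valued curve at a general point -/

/-- `d∕dt|₀ (h t)⁻¹ = −h₀⁻¹·ḣ·h₀⁻¹` for a unit-valued curve with `d∕dt|₀ h = M`. [folklore] -/
theorem hasDerivAt_units_inv {h : ℝ → 𝔸ˣ} {M : 𝔸} (hd : HasDerivAt (fun t : ℝ => ((h t : 𝔸ˣ) : 𝔸)) M 0) :
    HasDerivAt (fun t : ℝ => (((h t)⁻¹ : 𝔸ˣ) : 𝔸)) (-((((h 0)⁻¹ : 𝔸ˣ) : 𝔸) * M * (((h 0)⁻¹ : 𝔸ˣ) : 𝔸))) 0 := by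
  have hinv_eq : (fun t : ℝ => (((h t)⁻¹ : 𝔸ˣ) : 𝔸)) = fun t => Ring.inverse ((h t : 𝔸ˣ) : 𝔸) := by
    funext t; exact (Ring.inverse_unit _).symm
  have h1 : HasFDerivAt (Ring.inverse : 𝔸 → 𝔸) (-ContinuousLinearMap.mulLeftRight ℂ 𝔸 (((h 0)⁻¹ : 𝔸ˣ) : 𝔸) (((h 0)⁻¹ : 𝔸ˣ) : 𝔸)) ((h 0 : 𝔸ˣ) : 𝔸) :=
    hasFDerivAt_ringInverse (h 0)
  have h2 := (h1.restrictScalars ℝ).comp_hasDerivAt (0 : ℝ) hd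
  rw [hinv_eq]
  refine h2.congr_deriv ?_
  simp

/-! ## §2 The centre-stair transporter along a gauge family at a general point -/

/-- ★★ **THE TWISTED STAIR TRANSPORTER ALONG A GAUGE FAMILY, GENERAL POINT**: for unit fields `B` (background tower), `E` (moving tower) at level `j` and a gauge family `h : ℝ → (sites → 𝔸ˣ)`
with RIGHT-trivialised velocity `ω` (`d∕dt|₀ h_t(x) = ω(x)·h_0(x)`), the transporter `τ_i(t) = (E^{h_t})(Γ_{y,i})·B(Γ_{y,i})⁻¹` responds by a left multiplication:
`τ̇_i = (ω(ŷ) − P_i·ω(x_i)·P_i⁻¹)·τ_i(0)`, `P_i = (E^{h_0})(Γ_{y,i})`, `x_i = ŷ + disp Γ_{y,i}`. [cite: Balaban1985Averaging, (8)-(9) p.18, (58) p.27] -/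
theorem hasDerivAt_tstairU_gaugeFamily_at (B E : GaugeField P j 𝔸ˣ) {h : ℝ → Site P j → 𝔸ˣ} {ω : Site P j → 𝔸}
    (hd : ∀ x, HasDerivAt (fun t : ℝ => ((h t x : 𝔸ˣ) : 𝔸)) (ω x * ((h 0 x : 𝔸ˣ) : 𝔸)) 0) (y : Site P (j + 1)) (i : Idx P) :
    HasDerivAt (fun t : ℝ => ((tstairU B (gaugeActT (h t) E) y i : 𝔸ˣ) : 𝔸))
      ((ω (emb y) - ((holT (gaugeActT (h 0) E) (emb y) (stairWord i.2.1 (off i.1)) : 𝔸ˣ) : 𝔸) * ω (transl (emb y) (disp (stairWord i.2.1 (off i.1)))) *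
          (((holT (gaugeActT (h 0) E) (emb y) (stairWord i.2.1 (off i.1)))⁻¹ : 𝔸ˣ) : 𝔸)) *
        ((tstairU B (gaugeActT (h 0) E) y i : 𝔸ˣ) : 𝔸)) 0 := by
  -- letters
  set w := stairWord (d := P.d) i.2.1 (off i.1) with hw
  set e : 𝔸ˣ := holT E (emb y) w with he
  set b : 𝔸ˣ := holT B (emb y) w with hb
  set x₁ : Site P j := transl (emb y) (disp w) with hx₁
  -- the transporter as an explicit product
  have hfun : (fun t : ℝ => ((tstairU B (gaugeActT (h t) E) y i : 𝔸ˣ) : 𝔸))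
      = fun t : ℝ => ((h t (emb y) : 𝔸ˣ) : 𝔸) * ((e : 𝔸) * (((h t x₁)⁻¹ : 𝔸ˣ) : 𝔸) * ((b⁻¹ : 𝔸ˣ) : 𝔸)) := by
    funext t
    rw [tstairU_def, holT_gaugeActT, Units.val_mul, Units.val_mul, Units.val_mul]
    simp only [mul_assoc]
    rfl
  rw [hfun]
  have hA : HasDerivAt (fun t : ℝ => ((h t (emb y) : 𝔸ˣ) : 𝔸)) (ω (emb y) * ((h 0 (emb y) : 𝔸ˣ) : 𝔸)) 0 := hd (emb y)
  have hBinv : HasDerivAt (fun t : ℝ => (((h t x₁)⁻¹ : 𝔸ˣ) : 𝔸))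
      (-((((h 0 x₁)⁻¹ : 𝔸ˣ) : 𝔸) * (ω x₁ * ((h 0 x₁ : 𝔸ˣ) : 𝔸)) * (((h 0 x₁)⁻¹ : 𝔸ˣ) : 𝔸))) 0 :=
    hasDerivAt_units_inv (h := fun t => h t x₁) (hd x₁)
  have hB : HasDerivAt (fun t : ℝ => (e : 𝔸) * (((h t x₁)⁻¹ : 𝔸ˣ) : 𝔸) * ((b⁻¹ : 𝔸ˣ) : 𝔸))
      ((e : 𝔸) * (-((((h 0 x₁)⁻¹ : 𝔸ˣ) : 𝔸) * (ω x₁ * ((h 0 x₁ : 𝔸ˣ) : 𝔸)) * (((h 0 x₁)⁻¹ : 𝔸ˣ) : 𝔸))) * ((b⁻¹ : 𝔸ˣ) : 𝔸)) 0 :=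
    (hBinv.const_mul (e : 𝔸)).mul_const ((b⁻¹ : 𝔸ˣ) : 𝔸)
  have hprod := hA.mul hB
  refine hprod.congr_deriv ?_
  -- the target in the same letters
  rw [tstairU_def, holT_gaugeActT]
  rw [← he, ← hb, ← hx₁]
  simp only [mul_inv_rev, inv_inv, Units.val_mul, mul_assoc, Units.mul_inv_cancel_left, Units.inv_mul_cancel_left, neg_mul, mul_neg, sub_mul]
  rw [sub_eq_add_neg]

/-! ## §3 The one-level symmetric covariant frame along a gauge family at a general point -/

/-- ★★ **THE SYMMETRIC COVARIANT BLOCK FRAME ALONG A GAUGE FAMILY, GENERAL POINT**: with `τ = (i ↦ τ_i(0))` inside the `eml` ball (`‖τ − 1‖ < 1/3`, ✓`isAnalyticMean_eml`),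
`d∕dt|₀ w_sym(B; E^{h_t})(y) = D eml(τ)(i ↦ (ω(ŷ) − P_i·ω(x_i)·P_i⁻¹)·τ_i)`.  At `τ = 1` this is the arithmetic mean of FR₀. [cite: Balaban1985Averaging, (82) p.30, (87) p.31, (58) p.27] -/
theorem hasDerivAt_vframeCovU_gaugeFamily_at (B E : GaugeField P j 𝔸ˣ) {h : ℝ → Site P j → 𝔸ˣ} {ω : Site P j → 𝔸}
    (hd : ∀ x, HasDerivAt (fun t : ℝ => ((h t x : 𝔸ˣ) : 𝔸)) (ω x * ((h 0 x : 𝔸ˣ) : 𝔸)) 0) (y : Site P (j + 1))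
    (hτ : ‖(fun i : Idx P => ((tstairU B (gaugeActT (h 0) E) y i : 𝔸ˣ) : 𝔸)) - 1‖ < 1 / 3) :
    HasDerivAt (fun t : ℝ => ((vframeCovU B (gaugeActT (h t) E) y : 𝔸ˣ) : 𝔸))
      (fderiv ℂ (eml : (Idx P → 𝔸) → 𝔸) (fun i : Idx P => ((tstairU B (gaugeActT (h 0) E) y i : 𝔸ˣ) : 𝔸))
        fun i : Idx P =>
          (ω (emb y) - ((holT (gaugeActT (h 0) E) (emb y) (stairWord i.2.1 (off i.1)) : 𝔸ˣ) : 𝔸) * ω (transl (emb y) (disp (stairWord i.2.1 (off i.1)))) *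
              (((holT (gaugeActT (h 0) E) (emb y) (stairWord i.2.1 (off i.1)))⁻¹ : 𝔸ˣ) : 𝔸)) *
            ((tstairU B (gaugeActT (h 0) E) y i : 𝔸ˣ) : 𝔸)) 0 := by
  have hfun : (fun t : ℝ => ((vframeCovU B (gaugeActT (h t) E) y : 𝔸ˣ) : 𝔸))
      = (eml : (Idx P → 𝔸) → 𝔸) ∘ fun t : ℝ => fun i : Idx P => ((tstairU B (gaugeActT (h t) E) y i : 𝔸ˣ) : 𝔸) := by
    funext t; rw [Function.comp_apply, coe_vframeCovU]
  rw [hfun]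
  have hfam : HasDerivAt (fun t : ℝ => fun i : Idx P => ((tstairU B (gaugeActT (h t) E) y i : 𝔸ˣ) : 𝔸))
      (fun i : Idx P =>
        (ω (emb y) - ((holT (gaugeActT (h 0) E) (emb y) (stairWord i.2.1 (off i.1)) : 𝔸ˣ) : 𝔸) * ω (transl (emb y) (disp (stairWord i.2.1 (off i.1)))) *
            (((holT (gaugeActT (h 0) E) (emb y) (stairWord i.2.1 (off i.1)))⁻¹ : 𝔸ˣ) : 𝔸)) *
          ((tstairU B (gaugeActT (h 0) E) y i : 𝔸ˣ) : 𝔸)) 0 :=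
    hasDerivAt_pi.2 fun i => hasDerivAt_tstairU_gaugeFamily_at B E hd y i
  -- `eml` is differentiable at `τ`, inside its ball
  have hmem : (fun i : Idx P => ((tstairU B (gaugeActT (h 0) E) y i : 𝔸ˣ) : 𝔸)) ∈ ball (1 : Idx P → 𝔸) (1 / 3) := by
    rw [mem_ball_iff_norm]; exact hτ
  have heml : HasFDerivAt (eml : (Idx P → 𝔸) → 𝔸)
      (fderiv ℂ (eml : (Idx P → 𝔸) → 𝔸) (fun i : Idx P => ((tstairU B (gaugeActT (h 0) E) y i : 𝔸ˣ) : 𝔸)))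
      (fun i : Idx P => ((tstairU B (gaugeActT (h 0) E) y i : 𝔸ˣ) : 𝔸)) :=
    (((isAnalyticMean_eml (ι := Idx P) (𝔸 := 𝔸)).differentiableOn _ hmem).differentiableAt (isOpen_ball.mem_nhds hmem)).hasFDerivAt
  exact (heml.restrictScalars ℝ).comp_hasDerivAt_of_eq (0 : ℝ) hfam rfl

/-! ## §4 The accumulated frames along `U′^{g_t}` with frames against `U₀`: the inductive step at a general chart point -/

section Tower

open Summit.QuantumFields.YangMills.Theorems.Prop8Chart (emlIterU emlIterU_gaugeActT)
open Summit.QuantumFields.YangMills.Theorems.Prop7SymAvgTwSym (frameAccU frameAccU_succ dbarCovIterU dbarCovIterU_eq_gaugeActT_frameAccU)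
open B15DeterminingSets (embIter)

omit [NormedAlgebra ℂ 𝔸] [CompleteSpace 𝔸] in
/-- composition of gauge transformations (group algebra). [cite: Balaban1985Averaging, (8) p.18] -/
private theorem gaugeActT_gaugeActT' {k : ℕ} (u v : Site P k → 𝔸ˣ) (V : GaugeField P k 𝔸ˣ) :
    gaugeActT u (gaugeActT v V) = gaugeActT (fun x => u x * v x) V := by
  funext b
  simp only [gaugeActT_apply, mul_inv_rev, mul_assoc]

/-- ★★★ **THE INDUCTIVE STEP OF THE FRAME TOWER ALONG `U′^{g_t}`, FRAMES AGAINST `U₀`** ((97): `v_{k+1}(y) = v_k(ŷ)·w_k(y)`).  Let `g` be a gauge family through `1` with site derivatives `N`,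
`W_t := U′^{g_t}`, `ν := v_k(U₀, U′)`, and suppose the level-`k` accumulated frames respond as `d∕dt|₀ v_k(U₀, W_t)(x) = V(x)`.  Then, provided the level-`k` transporters
`τ_i(y) = tstairU Ū₀⁽ᵏ⁾ D̄ₖ y i` (`D̄ₖ = dbarCovIterU k U₀ U′` the actual double-bar field) lie in the `eml` ball,
`d∕dt|₀ v_{k+1}(U₀, W_t)(y) = V(ŷ)·w_k(y) + ν(ŷ)·D eml(τ(y))(i ↦ (ω(ŷ) − D̄ₖ(Γ_{y,i})·ω(x_i)·D̄ₖ(Γ_{y,i})⁻¹)·τ_i(y))` with the right-trivialised corrected velocity **`ω(x) = ν(x)⁻¹·(N(x̂⁽ᵏ⁾x) − V(x)·ν(x)⁻¹)·ν(x)`**.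
Proof: `D̄ₖ(W_t) = Ē′^{h_t}` exactly, `h_t = v_k(W_t)⁻¹·(g_t∘x̂⁽ᵏ⁾)`, `h_0 = ν⁻¹`, `ḣ·h_0⁻¹ = ω`; §3 and the product rule.  At `U′ = U₀` (`ν = 1`, `τ = 1`) this is FR₀'s `hasDerivAt_frameAccU_succ`.
[cite: Balaban1985Averaging, (97) p.32, (89)-(92) p.31, (82) p.30, (11) p.19; Balaban1985BackgroundPropagators, (3.19) p.393] -/
theorem hasDerivAt_frameAccU_succ_at (U₀ U' : GaugeField P 0 𝔸ˣ) {g : ℝ → Site P 0 → 𝔸ˣ} {N : Site P 0 → 𝔸} (hg0 : g 0 = fun _ => 1)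
    (hgd : ∀ x, HasDerivAt (fun t : ℝ => ((g t x : 𝔸ˣ) : 𝔸)) (N x) 0) (k : ℕ) {V : Site P k → 𝔸}
    (hF : ∀ x : Site P k, HasDerivAt (fun t : ℝ => ((frameAccU k U₀ (gaugeActT (g t) U') x : 𝔸ˣ) : 𝔸)) (V x) 0) (y : Site P (k + 1))
    (hτ : ‖(fun i : Idx P => ((tstairU (emlIterU k U₀) (dbarCovIterU k U₀ U') y i : 𝔸ˣ) : 𝔸)) - 1‖ < 1 / 3) :
    HasDerivAt (fun t : ℝ => ((frameAccU (k + 1) U₀ (gaugeActT (g t) U') y : 𝔸ˣ) : 𝔸))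
      (V (emb y) * ((vframeCovU (emlIterU k U₀) (dbarCovIterU k U₀ U') y : 𝔸ˣ) : 𝔸) +
        ((frameAccU k U₀ U' (emb y) : 𝔸ˣ) : 𝔸) *
          fderiv ℂ (eml : (Idx P → 𝔸) → 𝔸) (fun i : Idx P => ((tstairU (emlIterU k U₀) (dbarCovIterU k U₀ U') y i : 𝔸ˣ) : 𝔸))
            (fun i : Idx P =>
              ((((frameAccU k U₀ U' (emb y))⁻¹ : 𝔸ˣ) : 𝔸) * (N (embIter k (emb y)) - V (emb y) * (((frameAccU k U₀ U' (emb y))⁻¹ : 𝔸ˣ) : 𝔸)) *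
                    ((frameAccU k U₀ U' (emb y) : 𝔸ˣ) : 𝔸) -
                  ((holT (dbarCovIterU k U₀ U') (emb y) (stairWord i.2.1 (off i.1)) : 𝔸ˣ) : 𝔸) *
                      ((((frameAccU k U₀ U' (transl (emb y) (disp (stairWord i.2.1 (off i.1)))))⁻¹ : 𝔸ˣ) : 𝔸) *
                          (N (embIter k (transl (emb y) (disp (stairWord i.2.1 (off i.1))))) -
                            V (transl (emb y) (disp (stairWord i.2.1 (off i.1)))) *
                              (((frameAccU k U₀ U' (transl (emb y) (disp (stairWord i.2.1 (off i.1)))))⁻¹ : 𝔸ˣ) : 𝔸)) *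
                        ((frameAccU k U₀ U' (transl (emb y) (disp (stairWord i.2.1 (off i.1)))) : 𝔸ˣ) : 𝔸)) *
                    (((holT (dbarCovIterU k U₀ U') (emb y) (stairWord i.2.1 (off i.1)))⁻¹ : 𝔸ˣ) : 𝔸)) *
                ((tstairU (emlIterU k U₀) (dbarCovIterU k U₀ U') y i : 𝔸ˣ) : 𝔸))) 0 := by
  -- letters: `ν`, `ω`, the corrected family `h`
  set ν : Site P k → 𝔸ˣ := fun x => frameAccU k U₀ U' x with hν
  set ω : Site P k → 𝔸 := fun x => (((ν x)⁻¹ : 𝔸ˣ) : 𝔸) * (N (embIter k x) - V x * (((ν x)⁻¹ : 𝔸ˣ) : 𝔸)) * ((ν x : 𝔸ˣ) : 𝔸) with hω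
  set h : ℝ → Site P k → 𝔸ˣ := fun t x => (frameAccU k U₀ (gaugeActT (g t) U') x)⁻¹ * g t (embIter k x) with hh
  -- the level-`k` double bar is exactly `Ē′^{h_t}`
  have hD : ∀ t, dbarCovIterU k U₀ (gaugeActT (g t) U') = gaugeActT (h t) (emlIterU k U') := by
    intro t
    have hk := emlIterU_gaugeActT (fun i => fun x : Site P i => g t (embIter i x)) (fun i y => rfl) U' k
    have hus0 : (fun x : Site P 0 => g t (embIter 0 x)) = g t := rfl
    rw [hus0] at hk
    rw [dbarCovIterU_eq_gaugeActT_frameAccU, hk, gaugeActT_gaugeActT']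
  -- at `t = 0`
  have hW0 : gaugeActT (g 0) U' = U' := by
    funext b; rw [gaugeActT_apply, hg0, inv_one, one_mul, mul_one]
  have hg0e : ∀ x : Site P 0, g 0 x = 1 := fun x => by rw [hg0]
  have hF0 : ∀ x : Site P k, frameAccU k U₀ (gaugeActT (g 0) U') x = ν x := fun x => by rw [hW0]
  have hh0 : ∀ x : Site P k, h 0 x = (ν x)⁻¹ := fun x => by
    show (frameAccU k U₀ (gaugeActT (g 0) U') x)⁻¹ * g 0 (embIter k x) = (ν x)⁻¹
    rw [hF0, hg0e, mul_one]
  have hD0 : gaugeActT (h 0) (emlIterU k U') = dbarCovIterU k U₀ U' := by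
    rw [← hD 0, hW0]
  -- `ḣ = ω·h_0`
  have hhd : ∀ x : Site P k, HasDerivAt (fun t : ℝ => ((h t x : 𝔸ˣ) : 𝔸)) (ω x * ((h 0 x : 𝔸ˣ) : 𝔸)) 0 := by
    intro x
    have hinv : HasDerivAt (fun t : ℝ => (((frameAccU k U₀ (gaugeActT (g t) U') x)⁻¹ : 𝔸ˣ) : 𝔸))
        (-((((frameAccU k U₀ (gaugeActT (g 0) U') x)⁻¹ : 𝔸ˣ) : 𝔸) * V x * (((frameAccU k U₀ (gaugeActT (g 0) U') x)⁻¹ : 𝔸ˣ) : 𝔸))) 0 :=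
      hasDerivAt_units_inv (h := fun t => frameAccU k U₀ (gaugeActT (g t) U') x) (hF x)
    have hprod := hinv.mul (hgd (embIter k x))
    have hfun : (fun t : ℝ => ((h t x : 𝔸ˣ) : 𝔸)) = fun t => (((frameAccU k U₀ (gaugeActT (g t) U') x)⁻¹ : 𝔸ˣ) : 𝔸) * ((g t (embIter k x) : 𝔸ˣ) : 𝔸) := by
      funext t; rw [hh]; simp only [Units.val_mul]
    rw [hfun]
    refine hprod.congr_deriv ?_
    rw [hh0 x, hF0 x, hg0e, hω, Units.val_one, mul_one]
    simp only [mul_assoc, Units.mul_inv, mul_one, mul_sub, sub_mul]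
    abel
  -- §3 at level `k` along `h`, moved onto the actual double-bar field
  have hτ' : ‖(fun i : Idx P => ((tstairU (emlIterU k U₀) (gaugeActT (h 0) (emlIterU k U')) y i : 𝔸ˣ) : 𝔸)) - 1‖ < 1 / 3 := by
    rw [hD0]; exact hτ
  have hv := hasDerivAt_vframeCovU_gaugeFamily_at (emlIterU k U₀) (emlIterU k U') hhd y hτ'
  rw [hD0] at hv
  -- the accumulated frame: product rule
  have hfunF : (fun t : ℝ => ((frameAccU (k + 1) U₀ (gaugeActT (g t) U') y : 𝔸ˣ) : 𝔸))
      = fun t => ((frameAccU k U₀ (gaugeActT (g t) U') (emb y) : 𝔸ˣ) : 𝔸) * ((vframeCovU (emlIterU k U₀) (gaugeActT (h t) (emlIterU k U')) y : 𝔸ˣ) : 𝔸) := by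
    funext t; rw [frameAccU_succ, Units.val_mul, hD t]
  rw [hfunF]
  have hprod := (hF (emb y)).mul hv
  refine hprod.congr_deriv ?_
  rw [hD0, hF0]

end Tower

/-! ## §5 The one-level response operator off the identity: distance to the arithmetic mean -/

section OffIdentity

open BlockAveragingEMLAnalyticMean (norm_fderiv_eml_sub_mean_le norm_eml_add_sub_eml_le eml_one)
open B7TransferAnalyticMean (meanCLM norm_meanCLM_apply_le)

variable {ι : Type*} [Fintype ι]

/-- ★★ **`D eml(τ)(σ·τ) = (mean σ)·eml(τ) + O(‖σ‖‖τ − 1‖)`, CONSTANT `163`**: for `‖τ − 1‖ ≤ 1/24`,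
`‖D eml(τ)(σ·τ) − (mean σ)·eml τ‖ ≤ 163 ‖σ‖ ‖τ − 1‖` — so the response operator `𝔐_τ : σ ↦ D eml(τ)(σ·τ)·eml(τ)⁻¹` of §3–§4 is the arithmetic mean up to `O(‖τ − 1‖)`, and each
level of the frame-corrected operator is a perturbed block Ad-average (the per-level Neumann route to the onto-ness (P1)).  From ✓`norm_fderiv_eml_sub_mean_le` (`144`),
✓`norm_eml_add_sub_eml_le` (`12`) and `‖mean‖ ≤ 1`. [cite: Balaban1985Averaging, (82) p.30, (58) p.27; Balaban1987RG1, (0.8) p.253] -/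
theorem norm_fderiv_eml_mul_sub_mean_mul_le {τ : ι → 𝔸} (hτ : ‖τ - 1‖ ≤ 1 / 24) (σ : ι → 𝔸) :
    ‖fderiv ℂ (eml : (ι → 𝔸) → 𝔸) τ (σ * τ) - meanCLM ι 𝔸 σ * eml τ‖ ≤ 163 * ‖σ‖ * ‖τ - 1‖ := by
  -- the three pieces
  have h1 : ‖fderiv ℂ (eml : (ι → 𝔸) → 𝔸) τ (σ * τ) - meanCLM ι 𝔸 (σ * τ)‖ ≤ 144 * ‖σ * τ‖ * ‖τ - 1‖ := norm_fderiv_eml_sub_mean_le hτ (σ * τ)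
  have hστ : ‖σ * τ‖ ≤ ‖σ‖ * (1 + ‖τ - 1‖) := by
    have heq : σ * τ = σ + σ * (τ - 1) := by rw [mul_sub, mul_one, add_sub_cancel]
    rw [heq]
    calc ‖σ + σ * (τ - 1)‖ ≤ ‖σ‖ + ‖σ * (τ - 1)‖ := norm_add_le _ _
      _ ≤ ‖σ‖ + ‖σ‖ * ‖τ - 1‖ := by gcongr; exact norm_mul_le _ _
      _ = ‖σ‖ * (1 + ‖τ - 1‖) := by ring
  have h2 : ‖meanCLM ι 𝔸 (σ * τ) - meanCLM ι 𝔸 σ‖ ≤ ‖σ‖ * ‖τ - 1‖ := by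
    rw [← map_sub, show σ * τ - σ = σ * (τ - 1) by rw [mul_sub, mul_one]]
    exact (norm_meanCLM_apply_le _).trans (norm_mul_le _ _)
  have h3 : ‖eml τ - 1‖ ≤ 12 * ‖τ - 1‖ := by
    have h := norm_eml_add_sub_eml_le (ι := ι) (𝔸 := 𝔸) (U := 1) (V := τ - 1) (by rw [sub_self, norm_zero]; norm_num) hτ
    rwa [add_sub_cancel, eml_one] at h
  have h4 : ‖meanCLM ι 𝔸 σ - meanCLM ι 𝔸 σ * eml τ‖ ≤ ‖σ‖ * (12 * ‖τ - 1‖) := by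
    rw [show meanCLM ι 𝔸 σ - meanCLM ι 𝔸 σ * eml τ = meanCLM ι 𝔸 σ * (1 - eml τ) by rw [mul_sub, mul_one], ]
    calc ‖meanCLM ι 𝔸 σ * (1 - eml τ)‖ ≤ ‖meanCLM ι 𝔸 σ‖ * ‖1 - eml τ‖ := norm_mul_le _ _
      _ ≤ ‖σ‖ * (12 * ‖τ - 1‖) := by
        gcongr
        · exact norm_meanCLM_apply_le _
        · rw [norm_sub_rev]; exact h3
  -- assemble
  have hsplit : fderiv ℂ (eml : (ι → 𝔸) → 𝔸) τ (σ * τ) - meanCLM ι 𝔸 σ * eml τ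
      = (fderiv ℂ (eml : (ι → 𝔸) → 𝔸) τ (σ * τ) - meanCLM ι 𝔸 (σ * τ)) + (meanCLM ι 𝔸 (σ * τ) - meanCLM ι 𝔸 σ) + (meanCLM ι 𝔸 σ - meanCLM ι 𝔸 σ * eml τ) := by
    abel
  rw [hsplit]
  have ht0 : 0 ≤ ‖τ - 1‖ := norm_nonneg _
  have hs0 : 0 ≤ ‖σ‖ := norm_nonneg _
  calc ‖(fderiv ℂ (eml : (ι → 𝔸) → 𝔸) τ (σ * τ) - meanCLM ι 𝔸 (σ * τ)) + (meanCLM ι 𝔸 (σ * τ) - meanCLM ι 𝔸 σ) + (meanCLM ι 𝔸 σ - meanCLM ι 𝔸 σ * eml τ)‖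
      ≤ ‖fderiv ℂ (eml : (ι → 𝔸) → 𝔸) τ (σ * τ) - meanCLM ι 𝔸 (σ * τ)‖ + ‖meanCLM ι 𝔸 (σ * τ) - meanCLM ι 𝔸 σ‖ + ‖meanCLM ι 𝔸 σ - meanCLM ι 𝔸 σ * eml τ‖ :=
        norm_add₃_le
    _ ≤ 144 * (‖σ‖ * (1 + ‖τ - 1‖)) * ‖τ - 1‖ + ‖σ‖ * ‖τ - 1‖ + ‖σ‖ * (12 * ‖τ - 1‖) := by
        gcongr
        exact h1.trans (by gcongr)
    _ ≤ 163 * ‖σ‖ * ‖τ - 1‖ := by nlinarith [mul_nonneg hs0 ht0, mul_nonneg (mul_nonneg hs0 ht0) ht0]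

end OffIdentity

/-! ## §6 The per-level Neumann letter: a bounded operator within `‖a‖` of `a·1` is onto -/

section Neumann

/-- **NEUMANN ONTO-NESS**: a continuous linear `T` on a Banach space with `‖T − a•1‖ < ‖a‖` is surjective (indeed bijective): `a⁻¹T = 1 − (1 − a⁻¹T)` with `‖1 − a⁻¹T‖ < 1` is a unit
(✓`Units.oneSub`).  The letter that inverts each level of the frame-corrected operator (§5: the level map on centre/block-constant parameters is `(|I₀|/|I|)·1 + O(‖τ − 1‖)`). [folklore] -/
theorem surjective_of_norm_sub_smul_one_lt {E : Type*} [NormedAddCommGroup E] [NormedSpace ℂ E] [CompleteSpace E] {T : E →L[ℂ] E} {a : ℂ}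
    (h : ‖T - a • (1 : E →L[ℂ] E)‖ < ‖a‖) : Function.Surjective T := by
  have ha : a ≠ 0 := by
    rintro rfl
    rw [norm_zero] at h
    exact absurd h (not_lt.2 (norm_nonneg _))
  -- `S = a⁻¹T` is within `1` of the identity
  have hS : ‖(1 : E →L[ℂ] E) - a⁻¹ • T‖ < 1 := by
    have heq : (1 : E →L[ℂ] E) - a⁻¹ • T = -(a⁻¹ • (T - a • (1 : E →L[ℂ] E))) := by
      rw [smul_sub, smul_smul, inv_mul_cancel₀ ha, one_smul, neg_sub]
    rw [heq, norm_neg, norm_smul, norm_inv]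
    calc ‖a‖⁻¹ * ‖T - a • (1 : E →L[ℂ] E)‖ < ‖a‖⁻¹ * ‖a‖ := by gcongr
      _ = 1 := inv_mul_cancel₀ (norm_ne_zero_iff.2 ha)
  set u : (E →L[ℂ] E)ˣ := Units.oneSub ((1 : E →L[ℂ] E) - a⁻¹ • T) hS with hu
  have huT : (u : E →L[ℂ] E) = a⁻¹ • T := by
    rw [hu, Units.val_oneSub, sub_sub_cancel]
  intro y
  refine ⟨((u⁻¹ : (E →L[ℂ] E)ˣ) : E →L[ℂ] E) (a⁻¹ • y), ?_⟩
  have h1 : T = a • (u : E →L[ℂ] E) := by rw [huT, smul_smul, mul_inv_cancel₀ ha, one_smul]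
  rw [h1]
  show a • (((u : E →L[ℂ] E) * ((u⁻¹ : (E →L[ℂ] E)ˣ) : E →L[ℂ] E)) (a⁻¹ • y)) = y
  rw [Units.mul_inv]
  show a • (a⁻¹ • y) = y
  rw [smul_smul, mul_inv_cancel₀ ha, one_smul]

end Neumann

end Summit.QuantumFields.YangMills.Theorems.Prop7SymFrameGaugeResponseAt

end
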